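import Mathlib
import Summits.Ventures.PercRepro2.Defs
import Summits.Ventures.PercRepro2.Independence
import Summits.Ventures.PercRepro2.Harris
import Summits.Ventures.PercRepro2.Graph
import Summits.Ventures.PercRepro2.Exploration
import Summits.Ventures.PercRepro2.Events
import Summits.Ventures.PercRepro2.FourFunctions
import Summits.Ventures.PercRepro2.Induced
import Summits.Ventures.PercRepro2.Frontier
import Summits.Ventures.PercRepro2.ObsIndependence
import Summits.Ventures.PercRepro2.BHK
import Summits.Ventures.PercRepro2.BHKEvents
import Summits.Ventures.PercRepro2.SideAgreement
import Summits.Ventures.PercRepro2.VdBKahn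
import Summits.Ventures.PercRepro2.BHKAvoid
import Summits.Ventures.PercRepro2.R2PrimeThreeReduction
import Summits.Ventures.PercRepro2.YBridge
import Summits.Ventures.PercRepro2.Yu1Functionals
import Summits.Ventures.PercRepro2.Yu1Events
import Summits.Ventures.PercRepro2.Yu1
import Summits.Ventures.PercRepro2.LBSplit
import Summits.Ventures.PercRepro2.YDelta
import Summits.Ventures.PercRepro2.SD
import Summits.Ventures.PercRepro2.Threshold
import Summits.Ventures.PercRepro2.Lambda
import Summits.Ventures.PercRepro2.LambdaTau
import Summits.Ventures.PercRepro2.LambdaSlack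
import Summits.Ventures.PercRepro2.HF2
import Summits.Ventures.PercRepro2.Yu2
import Summits.Ventures.PercRepro2.N0
import Summits.Ventures.PercRepro2.Y
import Summits.Ventures.PercRepro2.YDeltaTools
import Summits.Ventures.PercRepro2.ZDelta
import Summits.Ventures.PercRepro2.ZExpand
import Summits.Ventures.PercRepro2.ISplit
import Summits.Ventures.PercRepro2.MRl
import Summits.Ventures.PercRepro2.ZOloc
import Summits.Ventures.PercRepro2.SideBridge
import Summits.Ventures.PercRepro2.HCov
import Summits.Ventures.PercRepro2.HullDefs
import Summits.Ventures.PercRepro2.HullFlip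
import Summits.Ventures.PercRepro2.HullTheoremA
import Summits.Ventures.PercRepro2.LocRows
import Summits.Ventures.PercRepro2.LocRows2

/-!
# (LOC-sym): the crux of record of the (DOM) family (blind cell PercRepro2, typer-1; lead g11
ASSIGNMENTS v11.11 11:13:44Z / CONJECTURES v2.99i–j: the swap-symmetric local bijection
`M_𝓤 → P_𝓤` recolouring only edges that touch the SOURCE's blue cluster AND the IMAGE's red cluster;
engine D53/D56 0 / 235,592 (n = 6 ALL graphs, ALL up-sets) and 0 / 40,669,921 (n = 7, m ≤ 9))

`LocSym` is the row of record: it is `LocRows.LocU₂` (source-side region `C_B(l)(ζ)`, image-side region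
`C_R(l)(ψ ζ)`), with its closure `LocSym_all` and the ladder step `locU_of_locSym`.
-/

namespace Summit.Ventures.PercRepro2

namespace LocRows

variable {V : Type*} {E : Type*} [Fintype E] [DecidableEq E]

open scoped Classical

/-- **(LOC-sym)**: the swap-symmetric two-sided local injection `srcU → tgtU`
(`ψ` recolours only edges at the source's `C_B(l)`, `ψ⁻¹` only edges at the image's `C_R(l)`). -/
def LocSym (ends : E → Sym2 V) (l h : V) (𝓤 : Set (Set V)) : Prop := LocU₂ ends l h 𝓤

/-- (LOC-sym) ⟹ (LOC-𝓤). -/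
theorem locU_of_locSym (ends : E → Sym2 V) (l h : V) (𝓤 : Set (Set V)) (hl : LocSym ends l h 𝓤) :
    LocU ends l h 𝓤 :=
  locU_of_locU₂ ends l h 𝓤 hl

/-- (LOC-sym) over all finite graphs, markings `l ≠ h` and up-sets `𝓤` (the (DOM)-family crux). -/
def LocSym_all : Prop :=
  ∀ (V E : Type) [Fintype V] [DecidableEq V] [Fintype E] [DecidableEq E] (ends : E → Sym2 V)
    (l h : V), l ≠ h → ∀ 𝓤 : Set (Set V), IsUpperSet 𝓤 → LocSym ends l h 𝓤

end LocRows

end Summit.Ventures.PercRepro2
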